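import Literature.Computability.MetaComplexity.GapMINKT
import Literature.Computability.MetaComplexity.GapMINKTAverageCase
import Literature.Computability.MetaComplexity.GapMINKTAverageCaseProofs
import Literature.Computability.MetaComplexity.AvgCaseDerandomization
import Literature.Computability.Complexity.PromiseZPPProofs
import HarnessLib

/-!
# `Gap MINKT ∈ Promise-P` under `DistNP ⊆ AvgP`: the assembly of Hirahara's Cor. 4.23 (proofs)

Sibling proof file of `GapMINKT.lean` (D-0014). The named fact
`Hirahara2018_gapMINKT_mem_PromiseP` (Hirahara, FOCS 2018 / ECCC TR18-138 rev. 1, Cor. 4.23: *if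
`DistNP ⊆ AvgP` then `Gap_{σ,τ}MINKT ∈ Promise-P` for some `σ(n,s) = s + O((log n)√s + (log n)²)`
and polynomial `τ`*) is proved in print in two sentences: "Buhrman, Fortnow and Pavan [BFP05]
showed that `DistNP ⊆ AvgP` implies the existence of a pseudorandom generator, and in particular,
`Promise-BPP = Promise-P`. Corollary 4.23 immediately follows by combining their result with
Corollary 4.22." This file formalises exactly that assembly, reducing the fact to its two
published ingredients (both vendored as named facts, each a substantial theory on its own):

* `BuhrmanFortnowPavan2004_PromiseBPP'_subset_PromiseP` (`AvgCaseDerandomization.lean`):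
  `DistNP ⊆ AvgP → PromiseBPP' ⊆ PromiseP`;
* `Hirahara2018_gapMINKT_mem_PromiseZPP` (`GapMINKTAverageCase.lean`): Cor. 4.22 (1 ⇒ 4),
  `DistNP ⊆ AvgP → Gap_{σ,τ}MINKT ∈ PromiseZPP'`;

through the proved inclusion `PromiseZPP' ⊆ PromiseBPP'` (`PromiseZPPProofs.lean`):

* `Hirahara2018_gapMINKT_mem_PromiseP_of_PromiseBPP'` — the assembly from the derandomisation fact
  and ANY proof that `Gap_{σ,τ}MINKT ∈ PromiseBPP'` with the stated parameters (the form a direct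
  formalisation of Thm. 4.21's two-sided-error algorithm, or of Thm. 4.24's, would deliver);
* `Hirahara2018_gapMINKT_mem_PromiseP_of` — the printed assembly (BFP + Cor. 4.22);
* `Hirahara2018_gapMINKT_mem_PromiseP_of_thm421` — the same with Cor. 4.22 (1 ⇒ 4) replaced by its
  one undischarged ingredient, Theorem 4.21 (`Hirahara2018_gapMINKT_mem_PromiseZPP_of_thm421`,
  `GapMINKTAverageCaseProofs.lean`): **Cor. 4.23 from Buhrman–Fortnow–Pavan and Theorem 4.21**, the
  trust base of the named fact in the tree;
* `Hirahara2018_gapMINKT_mem_PromiseZPP_of_PromiseP` — conversely Cor. 4.23 implies Cor. 4.22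
  (1 ⇒ 4) outright (`PromiseP ⊆ PromiseZPP'`), so the second ingredient is a genuine weakening;
* parameter monotonicity (`gapMINKT_mem_promiseLift_of_le`, `…_PromiseZPP'_of_le`,
  `…_PromiseBPP'_of_le`): enlarging `σ` or `τ` pointwise preserves membership (the no-part only
  shrinks, `gapMINKT_no_anti`), the normalisation used when matching parameter shapes.

Status of the discharge `Hirahara2018_gapMINKT_mem_PromiseP_holds`: CONDITIONAL on exactly two
named facts, Buhrman–Fortnow–Pavan (`BuhrmanFortnowPavan2004_PromiseBPP'_subset_PromiseP`: IW97 +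
BFLS/PS + Köbler–Schuler + BCGL + IKW, a theory of its own) and Hirahara's Theorem 4.21
(`Hirahara2018_gapMINKTSearch_of_AvgDeltaP`, `GapMINKTSearch.lean`, whose Lemma 4.17 is discharged
and whose open part is the Nisan–Wigderson / list-decoding reconstruction step, see
`GapMINKTReconstruction.lean`); every other step of the printed derivation — Cor. 4.22 (1 ⇒ 2)
through a dominating exactly samplable ensemble, Fact 4.15, Fact 3.8 as a genuine polynomial-time
decision procedure, the parameter machines, `Promise-ZPP ⊆ Promise-BPP`, and the assemblies — is a
theorem of the tree (`GapMINKTDenseRandom*Proofs.lean`, `GapMINKTSearchProofs.lean`,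
`GapMINKTAverageCaseProofs.lean`, `PromiseZPPProofs.lean`, this file). It lands as
`Hirahara2018_gapMINKT_mem_PromiseP_of_thm421 BFP_holds Thm421_holds` once both are discharged.

## References

* S. Hirahara, *Non-black-box worst-case to average-case reductions within NP*, FOCS 2018; ECCC
  TR18-138 rev. 1 (2019), Cor. 4.22, Cor. 4.23 and its proof, Def. 3.6 [Hirahara2018].
* H. Buhrman, L. Fortnow, A. Pavan, *Some results on derandomization*, Theory Comput. Syst. 38
  (2005), Thm. 3.1 [BuhrmanFortnowPavan2004].
-/

namespace Literature.Computability.MetaComplexity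

open _root_.Computability Complexity

namespace UniversalMachine

variable (U : UniversalMachine)

/-! ### Parameter monotonicity of `Gap MINKT` membership -/

/-- Enlarging `σ` or `τ` pointwise keeps `Gap_{σ,τ}MINKT` in any promise lift `promiseLift C`
(e.g. `PromiseP`): the yes-part is unchanged and the no-part shrinks (`gapMINKT_no_anti`).
[cite: Hirahara2018, Def. 3.6] -/
theorem gapMINKT_mem_promiseLift_of_le {C : Set (Language Bool)} {σ σ' τ τ' : ℕ → ℕ → ℕ}
    (hσ : ∀ n s, σ n s ≤ σ' n s) (hτ : ∀ n t, τ n t ≤ τ' n t)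
    (h : U.gapMINKT σ τ ∈ promiseLift C) : U.gapMINKT σ' τ' ∈ promiseLift C :=
  promiseLift_anti (Q := U.gapMINKT σ τ) (Q' := U.gapMINKT σ' τ') le_rfl (U.gapMINKT_no_anti hσ hτ) h

/-- Enlarging `σ` or `τ` pointwise keeps `Gap_{σ,τ}MINKT` in `PromiseZPP'` (`PromiseZPP'.anti`).
[cite: Hirahara2018, Def. 3.6] -/
theorem gapMINKT_mem_PromiseZPP'_of_le {σ σ' τ τ' : ℕ → ℕ → ℕ}
    (hσ : ∀ n s, σ n s ≤ σ' n s) (hτ : ∀ n t, τ n t ≤ τ' n t)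
    (h : U.gapMINKT σ τ ∈ PromiseZPP') : U.gapMINKT σ' τ' ∈ PromiseZPP' :=
  PromiseZPP'.anti (Q := U.gapMINKT σ τ) (Q' := U.gapMINKT σ' τ') le_rfl (U.gapMINKT_no_anti hσ hτ) h

/-- Enlarging `σ` or `τ` pointwise keeps `Gap_{σ,τ}MINKT` in `PromiseBPP'` (same witness language
and coin polynomial; the no-part shrinks). [cite: Hirahara2018, Def. 3.6] -/
theorem gapMINKT_mem_PromiseBPP'_of_le {σ σ' τ τ' : ℕ → ℕ → ℕ}
    (hσ : ∀ n s, σ n s ≤ σ' n s) (hτ : ∀ n t, τ n t ≤ τ' n t)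
    (h : U.gapMINKT σ τ ∈ PromiseBPP') : U.gapMINKT σ' τ' ∈ PromiseBPP' := by
  obtain ⟨L', hL', p, hy, hn⟩ := h
  exact ⟨L', hL', p, fun x hx => hy x hx, fun x hx => hn x (U.gapMINKT_no_anti hσ hτ hx)⟩

end UniversalMachine

/-! ### The assembly of Cor. 4.23 -/

/-- **Assembly of Hirahara's Cor. 4.23 from a `Promise-BPP` algorithm.** If `DistNP ⊆ AvgP`
derandomises promise-`BPP` (Buhrman–Fortnow–Pavan, the named fact
`BuhrmanFortnowPavan2004_PromiseBPP'_subset_PromiseP`) and, under `DistNP ⊆ AvgP`, `Gap_{σ,τ}MINKT`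
has a promise-`BPP` algorithm for parameters of the stated shape, then
`Hirahara2018_gapMINKT_mem_PromiseP` holds. [cite: Hirahara2018, proof of Cor. 4.23] -/
theorem Hirahara2018_gapMINKT_mem_PromiseP_of_PromiseBPP'
    (hBFP : BuhrmanFortnowPavan2004_PromiseBPP'_subset_PromiseP)
    (h : ∀ U : UniversalMachine, DistNP ⊆ AvgP →
      ∃ (σ τ : ℕ → ℕ → ℕ) (c : ℕ) (p : Polynomial ℕ),
        (∀ n s, s ≤ σ n s ∧ σ n s ≤ s + c * (Nat.log 2 n * Nat.sqrt s + Nat.log 2 n ^ 2 + 1)) ∧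
        (∀ n t, t ≤ τ n t ∧ τ n t ≤ p.eval (n + t)) ∧
        U.gapMINKT σ τ ∈ PromiseBPP') :
    Hirahara2018_gapMINKT_mem_PromiseP := by
  intro U hD
  obtain ⟨σ, τ, c, p, hσ, hτ, hmem⟩ := h U hD
  exact ⟨σ, τ, c, p, hσ, hτ, hBFP hD hmem⟩

/-- **The printed proof of Cor. 4.23**: Buhrman–Fortnow–Pavan (`Promise-BPP = Promise-P` under
`DistNP ⊆ AvgP`) combined with Cor. 4.22 (`Gap_{σ,τ}MINKT ∈ Promise-ZPP ⊆ Promise-BPP`,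
`PromiseZPP'_subset_PromiseBPP'`). [cite: Hirahara2018, proof of Cor. 4.23] -/
theorem Hirahara2018_gapMINKT_mem_PromiseP_of
    (hBFP : BuhrmanFortnowPavan2004_PromiseBPP'_subset_PromiseP)
    (h422 : Hirahara2018_gapMINKT_mem_PromiseZPP) : Hirahara2018_gapMINKT_mem_PromiseP :=
  Hirahara2018_gapMINKT_mem_PromiseP_of_PromiseBPP' hBFP fun U hD => by
    obtain ⟨σ, τ, c, p, hσ, hτ, hmem⟩ := h422 U hD
    exact ⟨σ, τ, c, p, hσ, hτ, PromiseZPP'_subset_PromiseBPP' hmem⟩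

/-- **Cor. 4.23 from Buhrman–Fortnow–Pavan and Theorem 4.21** — the sharpest assembly in the tree:
Cor. 4.22 (1 ⇒ 4) enters through `Hirahara2018_gapMINKT_mem_PromiseZPP_of_thm421`
(`GapMINKTAverageCaseProofs.lean`), in which (1 ⇒ 2), Fact 3.8 and the parameter machines are
discharged. [cite: Hirahara2018, proof of Cor. 4.23] -/
theorem Hirahara2018_gapMINKT_mem_PromiseP_of_thm421
    (hBFP : BuhrmanFortnowPavan2004_PromiseBPP'_subset_PromiseP)
    (h421 : Hirahara2018_gapMINKTSearch_of_AvgDeltaP) : Hirahara2018_gapMINKT_mem_PromiseP :=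
  Hirahara2018_gapMINKT_mem_PromiseP_of hBFP (Hirahara2018_gapMINKT_mem_PromiseZPP_of_thm421 h421)

/-- Conversely, Cor. 4.23 implies Cor. 4.22 (1 ⇒ 4) since `PromiseP ⊆ PromiseZPP'`
(`PromiseP_subset_PromiseZPP'`): the randomised statement is a weakening of the deterministic
one, and the derandomisation content of Cor. 4.23 is carried entirely by the BFP fact.
[cite: Hirahara2018, Cor. 4.22] -/
theorem Hirahara2018_gapMINKT_mem_PromiseZPP_of_PromiseP (h : Hirahara2018_gapMINKT_mem_PromiseP) :
    Hirahara2018_gapMINKT_mem_PromiseZPP := fun U hD => by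
  obtain ⟨σ, τ, c, p, hσ, hτ, hmem⟩ := h U hD
  exact ⟨σ, τ, c, p, hσ, hτ, PromiseP_subset_PromiseZPP' hmem⟩

end Literature.Computability.MetaComplexity
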